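import Literature.MathematicalPhysics.KineticTheory.Hilbert6LinearizedBoltzmann
import Literature.Analysis.UnboundedOperators.LinearizedBoltzmannSpectralGapProofs
import HarnessLib

/-!
# The linearised hard-sphere operator on `L²(M dv)`: the spectral gap of hilbert6.S19, reduced to the prelude fact

Sibling proof file of `Hilbert6LinearizedBoltzmann.lean` (D-0014), next to
`Hilbert6LinearizedBoltzmannProofs.lean` (the self-adjoint realisation). The named fact
`Literature.MathematicalPhysics.KineticTheory.hardSphereLinearizedOp_spectralGap`
(**hilbert6.S19**, spectral gap: in velocity dimension `d ≥ 2` there is `λ > 0` with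
`λ ‖g‖²_M ≤ -⟪g, L g⟫_M` for every `g` of temperate growth `M`-orthogonal to the collision
invariants, `L` the linearised hard-sphere collision operator on `ℝ^d`) is, verbatim, the
specialisation `E := EuclideanSpace ℝ (Fin d)` of the prelude fact
`Literature.Analysis.UnboundedOperators.le_neg_maxwellianInner_hardSphereLinearizedOp_of_orthogonal`
(stated for every finite-dimensional real inner product space `E` with `2 ≤ finrank ℝ E`).

This file proves the **glue** `hardSphereLinearizedOp_spectralGap_of`: the statement-file fact
from the prelude fact taken as an explicit hypothesis (D-0014; no new named fact is introduced),
so that the discharge `hardSphereLinearizedOp_spectralGap_holds` is the one-liner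
`hardSphereLinearizedOp_spectralGap_of le_neg_maxwellianInner_hardSphereLinearizedOp_of_orthogonal_holds`
— the prelude fact being discharged in
`Literature.Analysis.UnboundedOperators.LinearizedBoltzmannSpectralGapProofs` (fibre reduction +
one-dimensional coercivity, the polynomial gap of the sphere-averaged rectangle form, density of
polynomials in `L²(γ)`), the discharge `hardSphereLinearizedOp_spectralGap_holds` is recorded at the
end of this file.

## Sources

* C. Cercignani, R. Illner, M. Pulvirenti, *The Mathematical Theory of Dilute Gases*, Springer
  (Applied Mathematical Sciences 106, 1994), §7.2: Theorem 7.2.1, p. 197 (`L = K - ν(|ξ|) I`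
  self-adjoint and nonpositive, null space = the collision invariants), Theorem 7.2.4, p. 199
  (`K` compact), Theorem 7.2.5, p. 201 (*the spectrum of `L` is made up of a discrete and an
  essential spectrum: the former is contained in `(-ν₀, 0]`, the latter coincides with
  `(-∞, -ν₀]`* — Weyl's theorem), whence the gap below `0` on the orthogonal complement of the
  null space (dimension `3` in print; Grad's argument is dimension-free for `d ≥ 2`).
* C. Baranger, C. Mouhot, Rev. Mat. Iberoam. 21 (2005) 819–841, Theorem 1.1, p. 824 (explicit
  constant, dimension `N`, via `D^B ≥ C_{Φ,b} D^{B₀ ≡ 1}`).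
* H. Grad, *Asymptotic theory of the Boltzmann equation II*, Rarefied Gas Dynamics I (1963) 26–59
  (the original compactness/gap argument).

## Not here

The proof of the prelude fact itself (in print: Hilbert–Grad splitting `-L = ν - K` with `K`
compact, identification of the null space with the collision invariants in `L²(M)`, Weyl /
Fredholm, CIP 1994 §7.2; formalised instead along the constructive fibre / pseudo-Maxwellian
route): it lives in `Literature.Analysis.UnboundedOperators.LinearizedBoltzmannSpectralGapProofs`
and is only invoked here.
-/

open MeasureTheory ProbabilityTheory Module

namespace Literature.MathematicalPhysics.KineticTheory

noncomputable section

variable {d : ℕ}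

/-- **Glue for hilbert6.S19** (`hardSphereLinearizedOp_spectralGap`). The statement-file
spectral gap of the linearised hard-sphere operator on `L²(M dv)`, `M dv = stdGaussian ℝ^d`,
`d ≥ 2` — `∃ λ > 0, λ ‖g‖²_M ≤ -⟪g, L g⟫_M` for `g` of temperate growth `M`-orthogonal to the
collision invariants — follows from the prelude fact
`le_neg_maxwellianInner_hardSphereLinearizedOp_of_orthogonal` (CIP 1994 §7.2 Thm 7.2.5, p. 201;
Baranger–Mouhot 2005 Thm 1.1) specialised to `E = ℝ^d`, using `finrank ℝ ℝ^d = d`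
(`finrank_euclideanSpace_fin`). Feeding it the discharge of the prelude fact gives
`hardSphereLinearizedOp_spectralGap_holds`.
[cite: CIP1994, §7.2 Thm 7.2.5 p. 201] -/
theorem hardSphereLinearizedOp_spectralGap_of
    (h : Literature.Analysis.UnboundedOperators.le_neg_maxwellianInner_hardSphereLinearizedOp_of_orthogonal
      (E := V d)) :
    hardSphereLinearizedOp_spectralGap (d := d) := fun hd =>
  h (by simpa using hd)

/-- **Discharge of hilbert6.S19** (`hardSphereLinearizedOp_spectralGap`): the spectral gap of the
linearised hard-sphere collision operator on `L²(M dv)` in velocity dimension `d ≥ 2` — there is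
`λ > 0` with `λ ‖g‖²_M ≤ -⟪g, L g⟫_M` for every `g` of temperate growth `M`-orthogonal to the
collision invariants `1, v_i, |v|²`. Obtained from the discharged prelude fact
`Literature.Analysis.UnboundedOperators.le_neg_maxwellianInner_hardSphereLinearizedOp_of_orthogonal_holds`
(every finite-dimensional real inner product space `E` with `2 ≤ finrank ℝ E`; explicit
`λ = κ_d / (8 C₁)`, `κ_d = 16 σ(S^{d-1}) (d-1) / (3 d (d+2))`, `C₁` the Gaussian hard-rod constant)
at `E = ℝ^d` through the glue `hardSphereLinearizedOp_spectralGap_of`. In print: CIP 1994 §7.2,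
Theorem 7.2.1 p. 197 (`L` self-adjoint, nonpositive, null space = collision invariants) with
Theorem 7.2.4 p. 199 (`K` compact) and Theorem 7.2.5 p. 201 (discrete spectrum in `(-ν₀, 0]`,
essential spectrum `(-∞, -ν₀]`), whence the gap on the orthogonal complement of the null space
(dimension `3` in print); Baranger–Mouhot 2005 Theorem 1.1 p. 824 for the constructive estimate in
dimension `N`; Grad 1963 §4 for the original argument.
[cite: CIP1994, §7.2 Thm 7.2.5 p. 201] -/
theorem hardSphereLinearizedOp_spectralGap_holds : hardSphereLinearizedOp_spectralGap (d := d) :=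
  hardSphereLinearizedOp_spectralGap_of
    Literature.Analysis.UnboundedOperators.le_neg_maxwellianInner_hardSphereLinearizedOp_of_orthogonal_holds

end

end Literature.MathematicalPhysics.KineticTheory
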